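import Summits.BirchSwinnertonDyer.BirchSwinnertonDyer.Theses.AdditiveBranchIMC
import HarnessLib

/-! BC3 birth skeleton for crux `AdditiveBranchIMC.GordTwoRankZeroOffCaseOne` (route AdditiveBranchIMC, rung K1):
v2 (A12-admitted shape, planner g12): named stubs (the ONLY sorried declarations) + the kernel-checked composition `GordTwoRankZeroOffCaseOne_of` concluding the crux BY NAME. -/

set_option autoImplicit false

set_option linter.dupNamespace false

namespace Summit.BirchSwinnertonDyer.BirchSwinnertonDyer.Cruxes.GordTwoRankZeroOffCaseOne.Birth

open scoped Classical

open WeierstrassCurve Literature.NumberTheory.EllipticCurves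
  Literature.NumberTheory.EllipticCurves.ModularForms
  Literature.NumberTheory.EllipticCurves.GreenbergVatsal2000
  Literature.NumberTheory.EllipticCurves.Rank1Residual
  Literature.NumberTheory.EllipticCurves.Rank1Residual.Typed
  Literature.NumberTheory.GaloisRepresentations
  IsDedekindDomain NumberField

open Summit.BirchSwinnertonDyer.Rank1Residual.Additive
open Summit.BirchSwinnertonDyer.BirchSwinnertonDyer.Theses.AdditiveBranchIMC

/-- stub (irreducible): IRREDUCIBLE rows of cell (G-ord, e = 2), analytic rank 0: the ⊆(𝓛) direction on the ω^{(p−1)/2}-branch of the good ordinary twist V with V[p] ≅ E[p] ⊗ χ irreducible (Kato 17.4 divisibility + a branch main conjecture à la Skinner–Urban / Wan for the tame character; no Case-1 member exists on these rows since E[p] is irreducible). -/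
theorem stub_irreducible :
    ∀ (W : WeierstrassCurve ℚ) [W.IsElliptic] [W.IsGloballyMinimal] (p : ℕ) [Fact p.Prime],
      W.analyticRank = 0 → N10.CellGordTwo W p → W.HasIrreducibleModPGaloisRep p → MissingLowerBoundAt W p := by
  sorry

/-- stub (reducibleNoCaseOne): REDUCIBLE rows with NO Case-1 member (E[p]^ss ∋ an even unramified / odd ramified character on every member: Greenberg–Vatsal μ-territory): the lower bound from Greenberg's μ-formula for the branch + Kato, or from a published μ-free propagation (Fouquet 2024) once a base case on the branch exists. -/
theorem stub_reducibleNoCaseOne :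
    ∀ (W : WeierstrassCurve ℚ) [W.IsElliptic] [W.IsGloballyMinimal] (p : ℕ) [Fact p.Prime],
      W.analyticRank = 0 → N10.CellGordTwo W p → ¬ W.HasIrreducibleModPGaloisRep p → ¬ HasCaseOneMember W p →
        MissingLowerBoundAt W p := by
  sorry

/-- BC3 composition = THE SKELETON (A12 shape, v2): the crux BY NAME with NO hypotheses, from exactly the two
registered stubs (irreducible rows / reducible rows with no Case-1 member); kernel-checked, no sorry of its own. -/
theorem GordTwoRankZeroOffCaseOne_of :
    Summit.BirchSwinnertonDyer.BirchSwinnertonDyer.Theses.AdditiveBranchIMC.GordTwoRankZeroOffCaseOne := by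
  intro W _ _ p _ hr hc hno
  by_cases hi : W.HasIrreducibleModPGaloisRep p
  · exact stub_irreducible W p hr hc hi
  · exact stub_reducibleNoCaseOne W p hr hc hi hno

end Summit.BirchSwinnertonDyer.BirchSwinnertonDyer.Cruxes.GordTwoRankZeroOffCaseOne.Birth
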